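import Literature.NumberTheory.LFunctions.ZetaSpacingDensityRH
import Literature.NumberTheory.LFunctions.ZetaZerosWindowMomentsRH
import Literature.NumberTheory.LFunctions.MontgomeryTheoremTestFunctions
import Literature.NumberTheory.LFunctions.AlternativeHypothesis
import Literature.NumberTheory.LFunctions.RudnickSarnakPairSmoothed
import Literature.NumberTheory.LFunctions.MontgomeryPairCorrelation
import Literature.NumberTheory.LFunctions.AlternativeHypothesisCorollary4Proofs
import Literature.NumberTheory.LFunctions.MontgomeryZeroWindows
import Literature.Probability.Distributions.CharFunInversionSmoothing
import Literature.Analysis.Fourier.SelbergMajorantsFourier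
import Mathlib.Analysis.Fourier.Inversion
import HarnessLib

/-!
# Bui–Goldston–Milinovich–Montgomery 2023, Theorem 3 — PROOF (Proposition 1 and the assembly)

Topic `Literature/NumberTheory/LFunctions` (namespace `Literature.NumberTheory.LFunctions`, proof objects
in `BGMM2023`). PROOF LAYER (cell `landau-siegel`, §C literature harvest, seat ls-lit-typer-2; row
T-005 of `lit/HARVEST.md`): THEOREMS ONLY — no definitions of notions, no named facts. It DISCHARGES
the named fact `Literature.NumberTheory.LFunctions.buiEtAl2023_theorem3` of
`ZetaSpacingDensityRH.lean` as `Literature.NumberTheory.LFunctions.buiEtAl2023_theorem3_holds`,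
following the printed proof (H. M. Bui, D. A. Goldston, M. B. Milinovich, H. L. Montgomery, *Small gaps
and small spacings between zeta zeros*, Acta Arith. **210** (2023) 133–153 = arXiv:2208.02359, §2
Proposition 1 and §4), the "Selberg moment" half (§3, Proposition 2) being the sibling file
`ZetaZerosWindowMomentsRH.lean`. Mathlib's `RiemannHypothesis` (for `ζ` only) is an EXPLICIT
hypothesis wherever the source assumes RH. LABEL: **NOT RH-BEARING**. «The programme SEARCHES and
TYPES; no claim about Landau–Siegel zeros, Theorems 1–2 of arXiv:2211.02515 or a repaired Margin232
until a kernel theorem says so.»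

## What the source prints (held text `paper:arxiv-2208.02359`, chunks p0004–p0005, p0008)

> **Proposition 1.** Assume RH. If `r ∈ 𝒜(λ)`, then
> `Σ_{0<γ_d≤T} m(γ_d)(m(γ_d)−1) + Σ_{0<γ,γ'≤T, 0<|γ−γ'|≤2πλ/log T} 1 ≥ (c(λ;r) − o(1)) N(T)`.

Printed proof (p0005): "For functions `r ∈ 𝒜(λ)`, it follows that
`r(u) ≤ |r(u)| = |∫ r̂(α)e(αu)dα| ≤ ∫ |r̂| = ∫ r̂ = r(0) = 1`. Hence
`Σ_{|γ−γ'|≤2πλ/log T} 1 ≥ Σ r((γ−γ')log T/2π) w(γ−γ') = N(T)∫ r̂ F`. Since `F` and `r̂` are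
nonnegative, the inequality is still valid if we restrict the integral … to any finite interval.
Since `F` and `r̂` are even, by [Montgomery's theorem] `… ≥ N(T)∫_{−1}^{1} r̂ F =
N(T)(r̂(0) + 2∫_0^1 α r̂(α) dα + o(1)) = N(T)(1 + c(λ;r) + o(1))`. On the other hand
`Σ_{|γ−γ'|≤…} 1 = Σ m(γ_d)² + Σ_{0<|γ−γ'|≤…} 1` … and `N(T) = Σ m(γ_d)`." ("It can be shown that
if `r ∈ 𝒜(λ)`, then `r̂ ∈ L¹(ℝ)`", p0004.)

> **Proof of Theorem 3** (p0008). From Proposition 1, for large `T` at least one of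
> `Σ m(γ_d)(m(γ_d)−1) ≥ ¼ c N(T)` or `Σ_{0<|γ−γ'|≤2πλ/log T} 1 ≥ ¼ c N(T)` holds. In the first case
> Cauchy: `(¼cN)² ≤ (Σ_{m(γ_d)>1} 1)(Σ m(γ_d)⁴) ≪ (Σ_{m>1} 1) T log T` … `≤ N(T) D(λ,T)`. In the second,
> `Σ_{0<|γ−γ'|≤…} 1 = 2Σ_γ n(γ,λ)`, "two applications of Cauchy's inequality" and Proposition 2 give
> `≪ (T log T) D_d(λ,T)^{1/4} ≤ (T log T) D(λ,T)^{1/4}`. For (2.5): `Σ m(m−1) ≤ (n* − 1 + o(1))N(T)`.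

## What is formalised, and how (all inputs are tree theorems)

In the INDEX vocabulary of `ZetaSpacingDensityRH.lean` (`γ_n = zetaOrdinate n`, `N = zetaZeroCount`,
`I_T = zeroIndexSet T = range N(T)`, pairs `I_T × I_T` counted with multiplicity):

* Fourier bookkeeping for `r ∈ 𝒜(λ)` (`BGMM2023.IsAdmissible`): `𝓕r = r̂` (`cosTransform`) is real,
  even, continuous, `0 ≤ r̂ ≤ ‖r‖₁`; **`r̂ ∈ L¹`** (`BGMM2023.integrable_cosTransform` — the source's
  "it can be shown": Gaussian regularisation `∫ e^{−ξ²/c} r̂(ξ) dξ = ∫ K_c r → r(0)` by Mathlib's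
  multiplication formula and `Real.tendsto_integral_gaussian_smul'`, then Fatou); inversion `𝓕r̂ = r`
  (`Continuous.fourierInv_fourier_eq`) and `r ≤ r(0) = 1`.
* `BGMM2023.pairCount_ge_of_RH` — **Proposition 1** in the form actually used: under RH, for
  `r ∈ 𝒜(λ)` and `ε > 0`, `(1 + c(λ;r) − ε) N(T) ≤ #{(γ,γ') : |γ−γ'| ≤ 2πλ/log T}` for all large `T`
  (the tree's `pairCorrelationCount (−λ) λ T`). Inputs: the pair-sum identity
  `AH.sum_fourier_pairSpacing_eq_integral` (RH-free), `F ≥ 0` (`Montgomery.montgomeryFormFactor_nonneg`),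
  Montgomery's theorem in the Goldston–Montgomery uniform form
  (`Montgomery.montgomery_pair_correlation_sqrtLog`), the mass of `T^{−2|α|}log T` at `0`
  (`Montgomery.tendsto_integral_rpow_abs_mul_log_mul` with `h ≡ 1`, and continuity of `r̂` at `0` —
  no Lipschitz condition on `r̂` is needed for a LOWER bound), and `N(T) ∼ (T/2π)log T`
  (`RudnickSarnak.tendsto_zetaZeroCount_div_main`).
* `buiEtAl2023_theorem3_holds` — **Theorem 3**, both clauses, from Proposition 1 and
  `BGMM2023.sum_windowCount_pow_le_of_RH` (Proposition 2, sibling file): with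
  `ν(n) = #{n' > n : γ_{n'} − γ_n ≤ 2πλ/log T} ≤ N(γ_n+δ) − N(γ_n−δ)`, `Σ_n ν(n) = ½(#pairs − N(T))`
  and Cauchy `#{n : ν(n) ≥ 1} ≥ (Σν)²/Σν²`; for distinct gaps the pairs are routed through the top
  index of each block of equal ordinates (the printed `γ_d`), with `(m·ν)² ≤ W⁴`.

## References

* [BuiEtAl2023] H. M. Bui, D. A. Goldston, M. B. Milinovich, H. L. Montgomery, Acta Arith. 210 (2023)
  133–153, arXiv:2208.02359: §2 (2.1)–(2.5), Proposition 1 with proof, Theorem 3; §4 proof of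
  Theorem 3.
* [Montgomery1973] H. L. Montgomery, Proc. Sympos. Pure Math. 24 (1973), Theorem and (3) (tree:
  `MontgomeryTheoremGoldstonMontgomery.lean`, `AlternativeHypothesis.lean`).
* E. M. Stein, G. Weiss, *Introduction to Fourier Analysis on Euclidean Spaces* (1971), Ch. I
  Cor. 1.26 (`f ∈ L¹`, `f̂ ≥ 0`, `f` continuous at `0` ⇒ `f̂ ∈ L¹`) — the classical lemma behind
  "it can be shown".
-/

noncomputable section

open Complex Filter Set MeasureTheory Topology Finset Real
open scoped FourierTransform

namespace Literature.NumberTheory.LFunctions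

namespace BGMM2023

/-! ## Fourier bookkeeping for the class `𝒜(λ)` -/

/-- `r̂` is even. [cite: BuiEtAl2023, §2 (2.1)] -/
theorem cosTransform_neg (r : ℝ → ℝ) (ξ : ℝ) : cosTransform r (-ξ) = cosTransform r ξ := by
  unfold cosTransform
  congr 1 with u
  rw [show 2 * π * -ξ * u = -(2 * π * ξ * u) by ring, Real.cos_neg]

/-- `|r̂(ξ)| ≤ ‖r‖₁`. [cite: BuiEtAl2023, §2 (2.1)] -/
theorem abs_cosTransform_le {r : ℝ → ℝ} (hi : Integrable r) (ξ : ℝ) :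
    |cosTransform r ξ| ≤ ∫ u, |r u| := by
  unfold cosTransform
  refine (abs_integral_le_integral_abs).trans (integral_mono_of_nonneg (Eventually.of_forall fun u ↦
    abs_nonneg _) hi.abs (Eventually.of_forall fun u ↦ ?_))
  dsimp only
  rw [abs_mul]
  exact mul_le_of_le_one_right (abs_nonneg _) (Real.abs_cos_le_one _)

/-- The integrand of `r̂(ξ)` is integrable. [cite: BuiEtAl2023, §2 (2.1)] -/
theorem integrable_mul_cos {r : ℝ → ℝ} (hi : Integrable r) (ξ : ℝ) :
    Integrable fun u : ℝ ↦ r u * Real.cos (2 * π * ξ * u) := by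
  have hφ : MemLp (fun u : ℝ ↦ Real.cos (2 * π * ξ * u)) ⊤ volume :=
    memLp_top_of_bound (by fun_prop : Continuous fun u : ℝ ↦ Real.cos (2 * π * ξ * u)).aestronglyMeasurable 1
      (Eventually.of_forall fun u ↦ by rw [Real.norm_eq_abs]; exact Real.abs_cos_le_one _)
  have h1 : Integrable (fun u : ℝ ↦ Real.cos (2 * π * ξ * u) * r u) := hi.mul_of_top_right hφ
  exact h1.congr (Eventually.of_forall fun u ↦ mul_comm _ _)

/-- **`𝓕r = r̂` for a real even integrable `r`**: the Fourier transform of `u ↦ (r u : ℂ)` is the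
(real) cosine transform. [cite: BuiEtAl2023, §2 (2.1)] -/
theorem fourier_ofReal_eq_cosTransform {r : ℝ → ℝ} (heven : ∀ u, r (-u) = r u) (hi : Integrable r)
    (ξ : ℝ) : 𝓕 (fun u : ℝ ↦ (r u : ℂ)) ξ = (cosTransform r ξ : ℂ) := by
  apply Complex.ext
  · rw [Complex.ofReal_re, Real.fourier_real_eq_integral_exp_smul]
    have hint : Integrable (fun v : ℝ ↦ Complex.exp (↑(-2 * π * v * ξ) * I) • (r v : ℂ)) := by
      simp_rw [smul_eq_mul]
      have hgC : Integrable (fun v : ℝ ↦ (r v : ℂ)) := hi.ofReal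
      refine hgC.bdd_mul (c := 1) ?_ (Eventually.of_forall fun v ↦ ?_)
      · exact (by fun_prop : Continuous fun v : ℝ ↦ Complex.exp (↑(-2 * π * v * ξ) * I)).aestronglyMeasurable
      · rw [Complex.norm_exp_ofReal_mul_I]
    have h := integral_re hint
    simp only [RCLike.re_to_complex] at h
    rw [← h, cosTransform]
    refine integral_congr_ae (Eventually.of_forall fun v ↦ ?_)
    dsimp only
    rw [smul_eq_mul, Complex.re_mul_ofReal, Complex.exp_ofReal_mul_I_re,
      show (-2 * π * v * ξ : ℝ) = -(2 * π * ξ * v) by ring, Real.cos_neg, mul_comm]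
  · rw [Complex.ofReal_im]
    exact Literature.Analysis.Fourier.fourier_im_eq_zero_of_real_even heven ξ

/-- `r̂` is continuous (for `r ∈ L¹`). [cite: BuiEtAl2023, §2 (2.1)] -/
theorem continuous_cosTransform {r : ℝ → ℝ} (heven : ∀ u, r (-u) = r u) (hi : Integrable r) :
    Continuous (cosTransform r) := by
  have hc : Continuous (𝓕 (fun u : ℝ ↦ (r u : ℂ))) :=
    VectorFourier.fourierIntegral_continuous Real.continuous_fourierChar continuous_inner hi.ofReal
  have h2 : cosTransform r = fun ξ ↦ (𝓕 (fun u : ℝ ↦ (r u : ℂ)) ξ).re := by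
    funext ξ; rw [fourier_ofReal_eq_cosTransform heven hi, Complex.ofReal_re]
  rw [h2]
  exact Complex.continuous_re.comp hc

/-- **"It can be shown that if `r ∈ 𝒜(λ)`, then `r̂ ∈ L¹(ℝ)`"**: a continuous integrable even `r`
with `r̂ ≥ 0` has `r̂ ∈ L¹` (and `∫ r̂ = r(0)`). Gaussian regularisation: by the multiplication
formula and the Fourier transform of the Gaussian, `∫ e^{−ξ²/c} r̂(ξ) dξ = ∫ K_c(u) r(u) du → r(0)`
(`c → ∞`, heat-kernel approximate identity, Mathlib `Real.tendsto_integral_gaussian_smul'`); since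
`r̂ ≥ 0`, Fatou gives `∫ r̂ ≤ r(0) < ∞`. (Stein–Weiss, Ch. I Cor. 1.26.)
[cite: BuiEtAl2023, §2 (before Theorem 3)] -/
theorem integrable_cosTransform {r : ℝ → ℝ} (hc : Continuous r) (hi : Integrable r)
    (heven : ∀ u, r (-u) = r u) (hnn : ∀ α, 0 ≤ cosTransform r α) :
    Integrable (cosTransform r) := by
  set f : ℝ → ℂ := fun u ↦ (r u : ℂ) with hfdef
  have hf : Integrable f := hi.ofReal
  have hfc : Continuous f := Complex.continuous_ofReal.comp hc
  have hF : ∀ ξ, 𝓕 f ξ = (cosTransform r ξ : ℂ) := fourier_ofReal_eq_cosTransform heven hi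
  have hct : Continuous (cosTransform r) := continuous_cosTransform heven hi
  set B : ℝ := ∫ u, |r u| with hB
  have hbd : ∀ ξ, |cosTransform r ξ| ≤ B := abs_cosTransform_le hi
  -- Step 1: `∫ e^{−ξ²/c} 𝓕f(ξ) dξ → f 0`
  have hlim : Tendsto (fun c : ℝ ↦ ∫ ξ : ℝ, cexp (-((c⁻¹ : ℝ) : ℂ) * ‖ξ‖ ^ 2) * 𝓕 f ξ) atTop
      (𝓝 (f 0)) := by
    have T := Real.tendsto_integral_gaussian_smul' hf (v := (0 : ℝ)) hfc.continuousAt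
    refine T.congr' ?_
    filter_upwards [Ioi_mem_atTop (0 : ℝ)] with c hc
    have hc' : (0 : ℝ) < c := hc
    have hb : 0 < (((c⁻¹ : ℝ) : ℂ)).re := by
      rw [Complex.ofReal_re]; exact inv_pos.2 hc'
    have J : Integrable (fun ξ : ℝ ↦ cexp (-((c⁻¹ : ℝ) : ℂ) * ‖ξ‖ ^ 2)) := by
      have J0 := GaussianFourier.integrable_cexp_neg_mul_sq_norm_add hb 0 (0 : ℝ)
      simp only [zero_mul, add_zero] at J0
      exact J0
    -- multiplication formula
    have hflip := VectorFourier.integral_fourierIntegral_smul_eq_flip (L := innerₗ ℝ) (μ := volume)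
      (ν := volume) (f := f) (g := fun ξ : ℝ ↦ cexp (-((c⁻¹ : ℝ) : ℂ) * ‖ξ‖ ^ 2))
      Real.continuous_fourierChar continuous_inner hf J
    rw [flip_innerₗ] at hflip
    -- the Fourier transform of the Gaussian
    have hG : ∀ x : ℝ, VectorFourier.fourierIntegral 𝐞 volume (innerₗ ℝ)
        (fun ξ : ℝ ↦ cexp (-((c⁻¹ : ℝ) : ℂ) * ‖ξ‖ ^ 2)) x =
        (π * c : ℂ) ^ (Module.finrank ℝ ℝ / 2 : ℂ) * cexp (-π ^ 2 * c * ‖(0 : ℝ) - x‖ ^ 2) := by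
      intro x
      have key := fourier_gaussian_innerProductSpace (V := ℝ) (b := ((c⁻¹ : ℝ) : ℂ)) hb x
      rw [show VectorFourier.fourierIntegral 𝐞 volume (innerₗ ℝ)
        (fun ξ : ℝ ↦ cexp (-((c⁻¹ : ℝ) : ℂ) * ‖ξ‖ ^ 2)) x =
        𝓕 (fun ξ : ℝ ↦ cexp (-((c⁻¹ : ℝ) : ℂ) * ‖ξ‖ ^ 2)) x from rfl, key]
      have hcne : (c : ℂ) ≠ 0 := Complex.ofReal_ne_zero.2 hc'.ne'
      rw [zero_sub, norm_neg, Complex.ofReal_inv]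
      congr 1
      · rw [div_inv_eq_mul]
      · congr 1
        field_simp
    calc ∫ w : ℝ, ((π * c : ℂ) ^ (Module.finrank ℝ ℝ / 2 : ℂ) * cexp (-π ^ 2 * c * ‖(0 : ℝ) - w‖ ^ 2)) • f w
        = ∫ w : ℝ, f w • VectorFourier.fourierIntegral 𝐞 volume (innerₗ ℝ)
            (fun ξ : ℝ ↦ cexp (-((c⁻¹ : ℝ) : ℂ) * ‖ξ‖ ^ 2)) w := by
          refine integral_congr_ae (Eventually.of_forall fun w ↦ ?_)
          dsimp only
          rw [hG w, smul_eq_mul, smul_eq_mul, mul_comm]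
      _ = ∫ ξ : ℝ, VectorFourier.fourierIntegral 𝐞 volume (innerₗ ℝ) f ξ •
            cexp (-((c⁻¹ : ℝ) : ℂ) * ‖ξ‖ ^ 2) := hflip.symm
      _ = ∫ ξ : ℝ, cexp (-((c⁻¹ : ℝ) : ℂ) * ‖ξ‖ ^ 2) * 𝓕 f ξ := by
          refine integral_congr_ae (Eventually.of_forall fun ξ ↦ ?_)
          dsimp only
          rw [smul_eq_mul, mul_comm]; rfl
  -- Step 2: in real terms, `I_c := ∫ e^{−ξ²/c} r̂(ξ) dξ → r 0`
  have hgauss_int : ∀ {c : ℝ}, 0 < c →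
      Integrable fun ξ : ℝ ↦ cosTransform r ξ * Real.exp (-c⁻¹ * ξ ^ 2) := by
    intro c hc
    exact (integrable_exp_neg_mul_sq (inv_pos.2 hc)).bdd_mul (c := B) hct.aestronglyMeasurable
      (Eventually.of_forall fun ξ ↦ by rw [Real.norm_eq_abs]; exact hbd ξ)
  have hreal : ∀ {c : ℝ}, 0 < c →
      ∫ ξ : ℝ, cexp (-((c⁻¹ : ℝ) : ℂ) * ‖ξ‖ ^ 2) * 𝓕 f ξ =
        ((∫ ξ : ℝ, cosTransform r ξ * Real.exp (-c⁻¹ * ξ ^ 2) : ℝ) : ℂ) := by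
    intro c hc
    rw [← integral_complex_ofReal]
    refine integral_congr_ae (Eventually.of_forall fun ξ ↦ ?_)
    dsimp only
    rw [hF ξ, Real.norm_eq_abs, ← Complex.ofReal_pow, sq_abs, Complex.ofReal_mul, Complex.ofReal_exp]
    push_cast
    ring
  have hlimR : Tendsto (fun c : ℝ ↦ ∫ ξ : ℝ, cosTransform r ξ * Real.exp (-c⁻¹ * ξ ^ 2)) atTop
      (𝓝 (r 0)) := by
    have h1 : Tendsto (fun c : ℝ ↦ (∫ ξ : ℝ, cexp (-((c⁻¹ : ℝ) : ℂ) * ‖ξ‖ ^ 2) * 𝓕 f ξ).re) atTop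
        (𝓝 ((f 0).re)) := (Complex.continuous_re.tendsto _).comp hlim
    have h2 : (f 0).re = r 0 := by simp [hfdef]
    rw [h2] at h1
    refine h1.congr' ?_
    filter_upwards [Ioi_mem_atTop (0 : ℝ)] with c hc
    rw [hreal hc, Complex.ofReal_re]
  -- Step 3: Fatou along `c = n + 1`
  have hptw : ∀ ξ : ℝ, Tendsto (fun n : ℕ ↦ ENNReal.ofReal (cosTransform r ξ * Real.exp (-((n : ℝ) + 1)⁻¹ * ξ ^ 2)))
      atTop (𝓝 (ENNReal.ofReal (cosTransform r ξ))) := by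
    intro ξ
    refine (ENNReal.continuous_ofReal.tendsto _).comp ?_
    have h0 : Tendsto (fun n : ℕ ↦ -((n : ℝ) + 1)⁻¹ * ξ ^ 2) atTop (𝓝 (-(0 : ℝ) * ξ ^ 2)) := by
      refine Tendsto.mul_const _ (Tendsto.neg ?_)
      exact tendsto_inv_atTop_zero.comp (tendsto_natCast_atTop_atTop.atTop_add tendsto_const_nhds)
    have h1 : Tendsto (fun n : ℕ ↦ Real.exp (-((n : ℝ) + 1)⁻¹ * ξ ^ 2)) atTop (𝓝 1) := by
      have := (Real.continuous_exp.tendsto _).comp h0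
      simpa [Function.comp_def] using this
    simpa using (tendsto_const_nhds (x := cosTransform r ξ)).mul h1
  have hmeas : ∀ n : ℕ, Measurable fun ξ : ℝ ↦
      ENNReal.ofReal (cosTransform r ξ * Real.exp (-((n : ℝ) + 1)⁻¹ * ξ ^ 2)) := fun n ↦
    ENNReal.measurable_ofReal.comp (hct.mul (by fun_prop)).measurable
  have hintn : ∀ n : ℕ, ∫⁻ ξ, ENNReal.ofReal (cosTransform r ξ * Real.exp (-((n : ℝ) + 1)⁻¹ * ξ ^ 2)) =
      ENNReal.ofReal (∫ ξ, cosTransform r ξ * Real.exp (-((n : ℝ) + 1)⁻¹ * ξ ^ 2)) := fun n ↦ by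
    rw [← ofReal_integral_eq_lintegral_ofReal (hgauss_int (by positivity))
      (Eventually.of_forall fun ξ ↦ mul_nonneg (hnn ξ) (Real.exp_pos _).le)]
  have hlimN : Tendsto (fun n : ℕ ↦ ENNReal.ofReal (∫ ξ, cosTransform r ξ * Real.exp (-((n : ℝ) + 1)⁻¹ * ξ ^ 2)))
      atTop (𝓝 (ENNReal.ofReal (r 0))) :=
    (ENNReal.continuous_ofReal.tendsto _).comp
      (hlimR.comp (tendsto_natCast_atTop_atTop.atTop_add tendsto_const_nhds))
  have hfatou : ∫⁻ ξ, ENNReal.ofReal (cosTransform r ξ) ≤ ENNReal.ofReal (r 0) :=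
    calc ∫⁻ ξ, ENNReal.ofReal (cosTransform r ξ)
        = ∫⁻ ξ, liminf (fun n : ℕ ↦ ENNReal.ofReal (cosTransform r ξ * Real.exp (-((n : ℝ) + 1)⁻¹ * ξ ^ 2)))
            atTop := by
          refine lintegral_congr fun ξ ↦ ?_; rw [(hptw ξ).liminf_eq]
      _ ≤ liminf (fun n : ℕ ↦ ∫⁻ ξ, ENNReal.ofReal (cosTransform r ξ * Real.exp (-((n : ℝ) + 1)⁻¹ * ξ ^ 2)))
            atTop := lintegral_liminf_le hmeas
      _ = ENNReal.ofReal (r 0) := by simp_rw [hintn]; exact hlimN.liminf_eq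
  refine ⟨hct.aestronglyMeasurable, ?_⟩
  rw [hasFiniteIntegral_iff_ofReal (Eventually.of_forall hnn)]
  exact hfatou.trans_lt ENNReal.ofReal_lt_top

/-- **Fourier inversion for `r ∈ 𝒜(λ)`**: `𝓕r̂ = r` (both even; `r`, `r̂ ∈ L¹`, `r` continuous).
[cite: BuiEtAl2023, Proposition 1 (proof)] -/
theorem fourier_cosTransform_eq {r : ℝ → ℝ} (hc : Continuous r) (hi : Integrable r)
    (heven : ∀ u, r (-u) = r u) (hnn : ∀ α, 0 ≤ cosTransform r α) (x : ℝ) :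
    𝓕 (fun ξ : ℝ ↦ (cosTransform r ξ : ℂ)) x = (r x : ℂ) := by
  set f : ℝ → ℂ := fun u ↦ (r u : ℂ) with hfdef
  have hf : Integrable f := hi.ofReal
  have hfc : Continuous f := Complex.continuous_ofReal.comp hc
  have hF : 𝓕 f = fun ξ ↦ (cosTransform r ξ : ℂ) := funext (fourier_ofReal_eq_cosTransform heven hi)
  have hFi : Integrable (𝓕 f) := by
    rw [hF]; exact (integrable_cosTransform hc hi heven hnn).ofReal
  have hinv := hfc.fourierInv_fourier_eq hf hFi
  rw [hF] at hinv
  have h1 : 𝓕⁻ (fun ξ : ℝ ↦ (cosTransform r ξ : ℂ)) (-x) = f (-x) := by rw [hinv]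
  rw [Real.fourierInv_eq_fourier_neg, neg_neg] at h1
  rw [h1, hfdef]; dsimp only; rw [heven]

/-- **`r ≤ 1` on `𝒜(λ)`** ("`r(u) ≤ |r(u)| ≤ ∫|r̂| = ∫ r̂ = r(0) = 1`"): for continuous integrable even
`r` with `r̂ ≥ 0`, `r(u) ≤ r(0)`. [cite: BuiEtAl2023, Proposition 1 (proof)] -/
theorem le_map_zero_of_cosTransform_nonneg {r : ℝ → ℝ} (hc : Continuous r) (hi : Integrable r)
    (heven : ∀ u, r (-u) = r u) (hnn : ∀ α, 0 ≤ cosTransform r α) (u : ℝ) : r u ≤ r 0 := by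
  have hgi : Integrable (cosTransform r) := integrable_cosTransform hc hi heven hnn
  have hge : ∀ ξ, cosTransform r (-ξ) = cosTransform r ξ := cosTransform_neg r
  -- `r = 𝓕 r̂ = cosTransform r̂`
  have hr : ∀ y : ℝ, r y = cosTransform (cosTransform r) y := by
    intro y
    have h1 := fourier_cosTransform_eq hc hi heven hnn y
    rw [fourier_ofReal_eq_cosTransform hge hgi] at h1
    exact_mod_cast h1.symm
  rw [hr u, hr 0]
  set g := cosTransform r with hgdef
  show cosTransform g u ≤ cosTransform g 0
  simp only [cosTransform, mul_zero, zero_mul, Real.cos_zero, mul_one]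
  exact integral_mono (integrable_mul_cos hgi u) hgi fun ξ ↦
    mul_le_of_le_one_right (hnn ξ) (Real.cos_le_one _)

/-! ## Proposition 1 (the Montgomery side) -/

/-- `∫_{-1}^{1} |α| g(α) dα = 2 ∫_0^1 α g(α) dα` for an even continuous `g` ("since `F` and `r̂` are
even"). [cite: BuiEtAl2023, Proposition 1 (proof)] -/
theorem integral_abs_mul_of_even {g : ℝ → ℝ} (hge : ∀ a, g (-a) = g a) (hgc : Continuous g) :
    ∫ a in (-1 : ℝ)..1, |a| * g a = 2 * ∫ a in (0 : ℝ)..1, a * g a := by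
  have hii : ∀ a b : ℝ, IntervalIntegrable (fun a ↦ |a| * g a) volume a b := fun a b ↦
    (by fun_prop : Continuous fun a : ℝ ↦ |a| * g a).intervalIntegrable _ _
  rw [← intervalIntegral.integral_add_adjacent_intervals (hii (-1) 0) (hii 0 1)]
  have h1 : ∫ a in (-1 : ℝ)..0, |a| * g a = ∫ a in (0 : ℝ)..1, a * g a := by
    have h := intervalIntegral.integral_comp_neg (fun a ↦ |a| * g a) (a := (0 : ℝ)) (b := 1)
    rw [neg_zero] at h
    rw [← h]
    refine intervalIntegral.integral_congr fun a ha ↦ ?_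
    rw [Set.uIcc_of_le zero_le_one] at ha
    simp only [abs_neg, hge, abs_of_nonneg ha.1]
  have h2 : ∫ a in (0 : ℝ)..1, |a| * g a = ∫ a in (0 : ℝ)..1, a * g a := by
    refine intervalIntegral.integral_congr fun a ha ↦ ?_
    rw [Set.uIcc_of_le zero_le_one] at ha
    simp only [abs_of_nonneg ha.1]
  rw [h1, h2]; ring

/-- **Proposition 1, as used in the proof of Theorem 3.** Assume RH; let `λ > 0`, `r ∈ 𝒜(λ)` and
`ε > 0`. Then for all large `T`,
`(1 + c(λ;r) − ε) · N(T) ≤ #{(γ, γ') ∈ (0,T]² : |γ − γ'| ≤ 2πλ/log T}` (ordered pairs of zeros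
with multiplicity, diagonal included — the tree's `pairCorrelationCount (−λ) λ T`; the printed
left side `Σ m(γ_d)(m(γ_d)−1) + Σ_{0<|γ−γ'|≤…} 1` is this count minus `N(T) = Σ m(γ_d)`).
Printed proof followed line by line: `r ≤ 1`, `r ≤ 0` off `[−λ, λ]` and `0 < w ≤ 1` give
`#pairs ≥ Σ r((γ−γ')log T/2π) w(γ−γ') = (T/2π) log T ∫ F r̂` (explicit formula
`AH.sum_fourier_pairSpacing_eq_integral`, `𝓕r̂ = r`); `F, r̂ ≥ 0` restricts to `[−1, 1]`;
Montgomery's theorem (`Montgomery.montgomery_pair_correlation_sqrtLog`) and the mass of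
`T^{−2|α|} log T` at `0` (`Montgomery.tendsto_integral_rpow_abs_mul_log_mul`, continuity of `r̂` at
`0`) give `∫_{−1}^{1} F r̂ ≥ r̂(0) + 2∫_0^1 α r̂ − o(1) = 1 + c(λ;r) − o(1)`; finally
`N(T) ∼ (T/2π) log T` (`RudnickSarnak.tendsto_zetaZeroCount_div_main`).
[cite: BuiEtAl2023, Proposition 1] -/
theorem pairCount_ge_of_RH (hRH : RiemannHypothesis) {lam : ℝ} {r : ℝ → ℝ}
    (hr : IsAdmissible r lam) {ε : ℝ} (hε : 0 < ε) :
    ∃ T₀ : ℝ, ∀ T : ℝ, T₀ ≤ T →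
      (1 + cValue r - ε) * (zetaZeroCount T : ℝ) ≤ (pairCorrelationCount (-lam) lam T : ℝ) := by
  classical
  -- the test-function data
  set g : ℝ → ℝ := cosTransform r with hgdef
  have hg0 : ∀ a, 0 ≤ g a := hr.transform_nonneg
  have hge : ∀ a, g (-a) = g a := cosTransform_neg r
  have hgi : Integrable g :=
    integrable_cosTransform hr.continuous hr.integrable hr.even hr.transform_nonneg
  have hgc : Continuous g := continuous_cosTransform hr.even hr.integrable
  set B : ℝ := ∫ u, |r u| with hBdef
  have hgB : ∀ a, |g a| ≤ B := abs_cosTransform_le hr.integrable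
  have hgB' : ∀ a, g a ≤ B := fun a ↦ (le_abs_self _).trans (hgB a)
  have hB0 : 0 ≤ B := (hg0 0).trans (hgB' 0)
  have hFg : ∀ x, 𝓕 (fun a : ℝ ↦ (g a : ℂ)) x = (r x : ℂ) :=
    fourier_cosTransform_eq hr.continuous hr.integrable hr.even hr.transform_nonneg
  have hr1 : ∀ u, r u ≤ 1 := fun u ↦ (le_map_zero_of_cosTransform_nonneg hr.continuous
    hr.integrable hr.even hr.transform_nonneg u).trans_eq hr.map_zero
  have hc_def : cValue r = g 0 - 1 + 2 * ∫ a in (0 : ℝ)..1, a * g a := rfl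
  -- the tolerance `η`
  set D : ℝ := 2 + |cValue r| + 5 * B with hDdef
  have hD0 : 0 < D := by positivity
  set η : ℝ := min (ε / D) (1 / 2) with hηdef
  have hη0 : 0 < η := lt_min (div_pos hε hD0) (by norm_num)
  have hη1 : η ≤ 1 / 2 := min_le_right _ _
  have hηD : η * D ≤ ε := by
    calc η * D ≤ ε / D * D := mul_le_mul_of_nonneg_right (min_le_left _ _) hD0.le
      _ = ε := div_mul_cancel₀ ε hD0.ne'
  -- continuity of `g` at `0`
  obtain ⟨δ₀, hδ₀, hδ⟩ : ∃ δ₀ > 0, ∀ a : ℝ, |a| < δ₀ → |g a - g 0| < η := by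
    obtain ⟨δ₀, hδ₀, h⟩ := Metric.continuous_iff.1 hgc 0 η hη0
    refine ⟨δ₀, hδ₀, fun a ha ↦ ?_⟩
    have := h a (by rwa [Real.dist_eq, sub_zero])
    rwa [Real.dist_eq] at this
  set δ₁ : ℝ := min (δ₀ / 2) 1 with hδ₁def
  have hδ₁0 : 0 < δ₁ := lt_min (half_pos hδ₀) one_pos
  have hδ₁1 : δ₁ ≤ 1 := min_le_right _ _
  have hgδ : ∀ a ∈ Set.Icc (-δ₁) δ₁, g 0 - η ≤ g a := by
    intro a ha
    have h1 : |a| < δ₀ := by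
      rw [abs_lt]; constructor <;> linarith [ha.1, ha.2, min_le_left (δ₀ / 2) 1]
    have h2 := hδ a h1
    rw [abs_lt] at h2; linarith [h2.1]
  -- Montgomery's theorem, the kernel masses, the zero count
  obtain ⟨C, hC⟩ := Montgomery.montgomery_pair_correlation_sqrtLog hRH
  have hK : ∀ {c : ℝ}, 0 < c →
      Tendsto (fun T : ℝ ↦ ∫ a in (-c)..c, T ^ (-2 * |a|) * Real.log T) atTop (𝓝 1) := by
    intro c hc
    have h := Montgomery.tendsto_integral_rpow_abs_mul_log_mul hc (h := fun _ ↦ (1 : ℝ))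
      intervalIntegrable_const (B := 1) (fun a _ ↦ by simp) (Cg := 0) (δ := 1) one_pos
      (fun a _ ↦ by simp)
    simpa using h
  have hN := RudnickSarnak.tendsto_zetaZeroCount_div_main
  have hev : ∀ᶠ T : ℝ in atTop,
      (1 + cValue r - ε) * (zetaZeroCount T : ℝ) ≤ (pairCorrelationCount (-lam) lam T : ℝ) := by
    filter_upwards [hC, eventually_gt_atTop (1 : ℝ), eventually_ge_atTop (Real.exp ((|C| / η) ^ 2)),
      (hK hδ₁0).eventually (lt_mem_nhds (show (1 : ℝ) - η < 1 by linarith)),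
      (hK one_pos).eventually (gt_mem_nhds (show (1 : ℝ) < 2 by norm_num)),
      hN.eventually (gt_mem_nhds (show (1 : ℝ) < 1 + η by linarith))]
      with T hCT hT1 hTexp hK1 hK2 hNT
    have hT0 : 0 < T := by linarith
    set L : ℝ := Real.log T with hLdef
    have hL : 0 < L := Real.log_pos hT1
    set M : ℝ := T / (2 * π) * L with hMdef
    have hM : 0 < M := by positivity
    -- `|C|/√L ≤ η`
    have hCL : |C| / Real.sqrt L ≤ η := by
      have h1 : (|C| / η) ^ 2 ≤ L := by
        have := Real.log_le_log (Real.exp_pos _) hTexp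
        rwa [Real.log_exp] at this
      have h2 : |C| / η ≤ Real.sqrt L := Real.le_sqrt_of_sq_le h1
      have h3 : 0 < Real.sqrt L := Real.sqrt_pos.2 hL
      rw [div_le_iff₀ h3]
      rw [div_le_iff₀ hη0] at h2
      linarith [mul_comm η (Real.sqrt L)]
    -- Step A: the explicit formula, `Σ r(x_p) w_p = M ∫ F g`
    have hA : ∑ p ∈ zeroIndexSet T ×ˢ zeroIndexSet T,
        r (AH.pairSpacing T p) * montgomeryWeight (zetaOrdinate p.1 - zetaOrdinate p.2) =
        M * ∫ a, montgomeryFormFactor a T * g a := by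
      have h := AH.sum_fourier_pairSpacing_eq_integral g hgi hT1
      simp_rw [hFg] at h
      exact_mod_cast h
    -- Step B: `Σ r(x_p) w_p ≤ #pairs`
    have hBnd : ∑ p ∈ zeroIndexSet T ×ˢ zeroIndexSet T,
        r (AH.pairSpacing T p) * montgomeryWeight (zetaOrdinate p.1 - zetaOrdinate p.2) ≤
        (pairCorrelationCount (-lam) lam T : ℝ) := by
      unfold pairCorrelationCount
      rw [Finset.card_filter]
      push_cast
      refine Finset.sum_le_sum fun p _ ↦ ?_
      split_ifs with hP
      · rcases le_or_gt 0 (r (AH.pairSpacing T p)) with h0 | h0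
        · exact (mul_le_of_le_one_right h0 (montgomeryWeight_le_one _)).trans (hr1 _)
        · exact (mul_nonpos_of_nonpos_of_nonneg h0.le (montgomeryWeight_pos _).le).trans zero_le_one
      · have hx : lam < |AH.pairSpacing T p| := by
          by_contra hcon
          push Not at hcon
          apply hP
          have h1 : |zetaOrdinate p.1 - zetaOrdinate p.2| ≤ 2 * π * lam / L := by
            rw [AH.pairSpacing, abs_div, abs_mul, abs_of_pos hL, abs_of_pos Real.two_pi_pos,
              div_le_iff₀ Real.two_pi_pos] at hcon
            rw [le_div_iff₀ hL]; linarith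
          obtain ⟨h2, h3⟩ := abs_le.1 h1
          exact ⟨by rw [show 2 * π * -lam / L = -(2 * π * lam / L) by ring]; exact h2, h3⟩
        exact (mul_nonpos_of_nonpos_of_nonneg (hr.nonpos _ hx) (montgomeryWeight_pos _).le).trans
          le_rfl
    -- Step C: `∫ F g ≥ 1 + c − η(1 + 5B)`
    have hFc : Continuous fun a : ℝ ↦ montgomeryFormFactor a T := by
      unfold montgomeryFormFactor; fun_prop
    have hF0 : ∀ a, 0 ≤ montgomeryFormFactor a T := fun a ↦
      Montgomery.montgomeryFormFactor_nonneg a hT1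
    have hFgi : Integrable fun a ↦ montgomeryFormFactor a T * g a :=
      hgi.bdd_mul (c := |2 * π / (T * Real.log T)| * ((zeroIndexSet T ×ˢ zeroIndexSet T).card : ℝ))
        hFc.aestronglyMeasurable
        (Eventually.of_forall fun a ↦ by rw [Real.norm_eq_abs]; exact abs_montgomeryFormFactor_le a T)
    have hC1 : ∫ a in (-1 : ℝ)..1, montgomeryFormFactor a T * g a ≤
        ∫ a, montgomeryFormFactor a T * g a := by
      rw [intervalIntegral.integral_of_le (by norm_num : (-1 : ℝ) ≤ 1)]
      exact setIntegral_le_integral hFgi (Eventually.of_forall fun a ↦ mul_nonneg (hF0 a) (hg0 a))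
    -- the kernel `K(α) = T^{-2|α|} log T`
    set K : ℝ → ℝ := fun a ↦ T ^ (-2 * |a|) * L with hKdef
    have hKc : Continuous K := by
      have e : K = fun a ↦ Real.exp (Real.log T * (-2 * |a|)) * L := by
        funext a; simp only [hKdef]; rw [Real.rpow_def_of_pos hT0]
      rw [e]; fun_prop
    have hK0 : ∀ a, 0 ≤ K a := fun a ↦ mul_nonneg (Real.rpow_nonneg hT0.le _) hL.le
    -- Montgomery pointwise on `[−1, 1]`: `F ≥ (1 − η) K + |α| − η`
    have hMont : ∀ a ∈ Set.Icc (-1 : ℝ) 1,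
        (1 - η) * K a + |a| - η ≤ montgomeryFormFactor a T := by
      intro a ha
      have ha' : |a| ≤ 1 := abs_le.2 ⟨ha.1, ha.2⟩
      have h1 := hCT a ha'
      have hKa : T ^ (-2 * |a|) * L = K a := by simp only [hKdef]
      have hKa' : T ^ (-2 * |a|) * Real.log T = K a := by simp only [hKdef, hLdef]
      rw [hKa'] at h1
      have hs : 0 < Real.sqrt L := Real.sqrt_pos.2 hL
      have hKa1 : 0 ≤ K a + 1 := by linarith [hK0 a]
      have h2 : C * (K a + 1) / Real.sqrt L ≤ η * (K a + 1) :=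
        calc C * (K a + 1) / Real.sqrt L ≤ |C| * (K a + 1) / Real.sqrt L :=
              div_le_div_of_nonneg_right (mul_le_mul_of_nonneg_right (le_abs_self C) hKa1) hs.le
          _ = |C| / Real.sqrt L * (K a + 1) := by rw [mul_div_right_comm]
          _ ≤ η * (K a + 1) := mul_le_mul_of_nonneg_right hCL hKa1
      have h3 := (abs_le.1 (h1.trans h2)).1
      linarith
    -- the three pieces `X = ∫ K g`, `Y = ∫ |α| g`, `Z = ∫ g` over `[−1, 1]`
    have hKgc : Continuous fun a ↦ K a * g a := hKc.mul hgc
    have hag : Continuous fun a : ℝ ↦ |a| * g a := by fun_prop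
    set X : ℝ := ∫ a in (-1 : ℝ)..1, K a * g a with hXdef
    set Y : ℝ := ∫ a in (-1 : ℝ)..1, |a| * g a with hYdef
    set Z : ℝ := ∫ a in (-1 : ℝ)..1, g a with hZdef
    have hlow : (1 - η) * X + Y - η * Z ≤ ∫ a in (-1 : ℝ)..1, montgomeryFormFactor a T * g a := by
      have h1 : ∫ a in (-1 : ℝ)..1, ((1 - η) * K a + |a| - η) * g a = (1 - η) * X + Y - η * Z := by
        have e : ∀ a : ℝ, ((1 - η) * K a + |a| - η) * g a =
            (1 - η) * (K a * g a) + |a| * g a - η * g a := fun a ↦ by ring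
        simp_rw [e]
        rw [intervalIntegral.integral_sub, intervalIntegral.integral_add,
          intervalIntegral.integral_const_mul, intervalIntegral.integral_const_mul]
        · exact ((hKgc.intervalIntegrable _ _).const_mul _)
        · exact hag.intervalIntegrable _ _
        · exact ((hKgc.intervalIntegrable _ _).const_mul _).add (hag.intervalIntegrable _ _)
        · exact (hgc.intervalIntegrable _ _).const_mul _
      rw [← h1]
      refine intervalIntegral.integral_mono_on (by norm_num)
        ((by fun_prop : Continuous fun a : ℝ ↦ ((1 - η) * K a + |a| - η) * g a).intervalIntegrable _ _)
        ((hFc.mul hgc).intervalIntegrable _ _) fun a ha ↦ ?_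
      exact mul_le_mul_of_nonneg_right (hMont a ha) (hg0 a)
    -- `X ≥ g 0 − η − η B`
    have hX0 : 0 ≤ X := intervalIntegral.integral_nonneg (by norm_num) fun a _ ↦
      mul_nonneg (hK0 a) (hg0 a)
    have hX1 : (g 0 - η) * ∫ a in (-δ₁)..δ₁, K a ≤ X := by
      have h1 : (g 0 - η) * ∫ a in (-δ₁)..δ₁, K a ≤ ∫ a in (-δ₁)..δ₁, K a * g a := by
        rw [← intervalIntegral.integral_const_mul]
        refine intervalIntegral.integral_mono_on (by linarith) ((hKc.intervalIntegrable _ _).const_mul _)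
          (hKgc.intervalIntegrable _ _) fun a ha ↦ ?_
        rw [mul_comm]
        exact mul_le_mul_of_nonneg_left (hgδ a ha) (hK0 a)
      have h2 : ∫ a in (-δ₁)..δ₁, K a * g a ≤ X :=
        intervalIntegral.integral_mono_interval (by linarith) (by linarith) hδ₁1
          (Eventually.of_forall fun a ↦ mul_nonneg (hK0 a) (hg0 a)) (hKgc.intervalIntegrable _ _)
      exact h1.trans h2
    have hX2 : g 0 - η - η * B ≤ X := by
      have hk1 : 1 - η < ∫ a in (-δ₁)..δ₁, K a := hK1
      have hηB : 0 ≤ η * B := mul_nonneg hη0.le hB0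
      rcases le_or_gt 0 (g 0 - η) with h0 | h0
      · have h5 : (g 0 - η) * (1 - η) ≤ (g 0 - η) * ∫ a in (-δ₁)..δ₁, K a :=
          mul_le_mul_of_nonneg_left hk1.le h0
        have e3 : η * g 0 ≤ η * B := mul_le_mul_of_nonneg_left (hgB' 0) hη0.le
        have e4 : (g 0 - η) * (1 - η) = g 0 - η - η * g 0 + η ^ 2 := by ring
        linarith [sq_nonneg η, e3, e4, h5, hX1]
      · linarith [hX0, hηB]
    -- `X ≤ 2B`, `Z ≤ 2B`
    have hK2' : ∫ a in (-1 : ℝ)..1, K a < 2 := hK2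
    have hX3 : X ≤ 2 * B := by
      have h1 : X ≤ ∫ a in (-1 : ℝ)..1, K a * B :=
        intervalIntegral.integral_mono_on (by norm_num) (hKgc.intervalIntegrable _ _)
          ((hKc.mul continuous_const).intervalIntegrable _ _) fun a _ ↦
          mul_le_mul_of_nonneg_left (hgB' a) (hK0 a)
      rw [intervalIntegral.integral_mul_const] at h1
      have h2 : (∫ a in (-1 : ℝ)..1, K a) * B ≤ 2 * B := mul_le_mul_of_nonneg_right hK2'.le hB0
      linarith
    have hZ0 : 0 ≤ Z := intervalIntegral.integral_nonneg (by norm_num) fun a _ ↦ hg0 a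
    have hZ1 : Z ≤ 2 * B := by
      have h1 : Z ≤ ∫ _ in (-1 : ℝ)..1, B :=
        intervalIntegral.integral_mono_on (by norm_num) (hgc.intervalIntegrable _ _)
          (continuous_const.intervalIntegrable _ _) fun a _ ↦ hgB' a
      have h2 : ∫ _ in (-1 : ℝ)..1, B = 2 * B := by
        rw [intervalIntegral.integral_const, smul_eq_mul]; norm_num
      linarith
    -- `Y = c + 1 − g 0`
    have hY : Y = cValue r + 1 - g 0 := by
      rw [hYdef, integral_abs_mul_of_even hge hgc, hc_def]; ring
    -- assemble: `∫ F g ≥ 1 + c − η (1 + 5 B)`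
    have hInt : 1 + cValue r - η * (1 + 5 * B) ≤ ∫ a, montgomeryFormFactor a T * g a := by
      have e1 : η * X ≤ η * (2 * B) := mul_le_mul_of_nonneg_left hX3 hη0.le
      have e2 : η * Z ≤ η * (2 * B) := mul_le_mul_of_nonneg_left hZ1 hη0.le
      have e3 : (1 - η) * X + Y - η * Z = X - η * X + Y - η * Z := by ring
      linarith [hX2, e1, e2, e3, hlow, hC1, hY]
    -- `#pairs ≥ M (1 + c − η(1 + 5B))` and `N(T) ≤ (1 + η) M`
    have hP2 : M * (1 + cValue r - η * (1 + 5 * B)) ≤ (pairCorrelationCount (-lam) lam T : ℝ) := by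
      calc M * (1 + cValue r - η * (1 + 5 * B)) ≤ M * ∫ a, montgomeryFormFactor a T * g a :=
            mul_le_mul_of_nonneg_left hInt hM.le
        _ = _ := hA.symm
        _ ≤ _ := hBnd
    have hNle : (zetaZeroCount T : ℝ) ≤ (1 + η) * M := by
      have h1 : (zetaZeroCount T : ℝ) / (T / (2 * π) * Real.log T) < 1 + η := hNT
      rw [div_lt_iff₀ hM] at h1
      exact h1.le
    -- conclusion
    rcases le_or_gt (1 + cValue r - ε) 0 with hneg | hpos
    · exact (mul_nonpos_of_nonpos_of_nonneg hneg (Nat.cast_nonneg _)).trans (Nat.cast_nonneg _)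
    · have h1 : (1 + cValue r - ε) * (zetaZeroCount T : ℝ) ≤ (1 + cValue r - ε) * ((1 + η) * M) :=
        mul_le_mul_of_nonneg_left hNle hpos.le
      have h2 : (1 + cValue r - ε) * (1 + η) ≤ 1 + cValue r - η * (1 + 5 * B) := by
        have h3 : cValue r ≤ |cValue r| := le_abs_self _
        have h4 : η * (1 + cValue r - ε) + η * (1 + 5 * B) ≤ η * D := by
          rw [← mul_add]
          exact mul_le_mul_of_nonneg_left (by rw [hDdef]; linarith) hη0.le
        have e5 : (1 + cValue r - ε) * (1 + η) = (1 + cValue r - ε) + η * (1 + cValue r - ε) := by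
          ring
        linarith [h4, hηD, e5]
      calc (1 + cValue r - ε) * (zetaZeroCount T : ℝ) ≤ (1 + cValue r - ε) * ((1 + η) * M) := h1
        _ = M * ((1 + cValue r - ε) * (1 + η)) := by ring
        _ ≤ M * (1 + cValue r - η * (1 + 5 * B)) := mul_le_mul_of_nonneg_left h2 hM.le
        _ ≤ _ := hP2
  obtain ⟨T₀, hT₀⟩ := eventually_atTop.1 hev
  exact ⟨T₀, hT₀⟩

/-! ## Theorem 3: ordered pairs, small spacings and small distinct gaps (the §4 assembly) -/

/-- Pairs versus later indices: `#{(n,m) ∈ [0,M)² : |γ_n − γ_m| ≤ δ} ≤ M + 2 Σ_n ν(n)` with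
`ν(n) = #{m > n : γ_m − γ_n ≤ δ}` ("`Σ_{0<|γ−γ'|≤…} 1 = 2 Σ_γ n(γ, λ)`" plus the diagonal).
[cite: BuiEtAl2023, §4 (proof of Theorem 3)] -/
theorem card_pairFilter_le (M : ℕ) (δ : ℝ) :
    ((Finset.range M ×ˢ Finset.range M).filter fun p : ℕ × ℕ ↦
        -δ ≤ zetaOrdinate p.1 - zetaOrdinate p.2 ∧ zetaOrdinate p.1 - zetaOrdinate p.2 ≤ δ).card ≤
      M + 2 * ∑ n ∈ Finset.range M,
        ((Finset.range M).filter fun m ↦ n < m ∧ zetaOrdinate m - zetaOrdinate n ≤ δ).card := by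
  rw [Finset.card_filter, Finset.sum_product]
  have hpt : ∀ n m : ℕ,
      (if -δ ≤ zetaOrdinate n - zetaOrdinate m ∧ zetaOrdinate n - zetaOrdinate m ≤ δ then 1 else 0) ≤
        (if n = m then 1 else 0) + (if n < m ∧ zetaOrdinate m - zetaOrdinate n ≤ δ then 1 else 0) +
          (if m < n ∧ zetaOrdinate n - zetaOrdinate m ≤ δ then 1 else 0) := by
    intro n m
    by_cases h1 : -δ ≤ zetaOrdinate n - zetaOrdinate m ∧ zetaOrdinate n - zetaOrdinate m ≤ δ
    · rw [if_pos h1]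
      rcases lt_trichotomy n m with h | h | h
      · have hU : n < m ∧ zetaOrdinate m - zetaOrdinate n ≤ δ := ⟨h, by linarith [h1.1]⟩
        rw [if_pos hU]; exact Nat.le_add_right_of_le (Nat.le_add_left 1 _)
      · rw [if_pos h]; exact Nat.le_add_right_of_le (Nat.le_add_right 1 _)
      · have hL : m < n ∧ zetaOrdinate n - zetaOrdinate m ≤ δ := ⟨h, h1.2⟩
        rw [if_pos hL]; exact Nat.le_add_left 1 _
    · rw [if_neg h1]; exact Nat.zero_le _
  have hA : ∑ n ∈ Finset.range M, ∑ m ∈ Finset.range M, (if n = m then 1 else 0) = M := by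
    calc ∑ n ∈ Finset.range M, ∑ m ∈ Finset.range M, (if n = m then 1 else 0)
        = ∑ n ∈ Finset.range M, 1 := by
          refine Finset.sum_congr rfl fun n hn ↦ ?_
          rw [Finset.sum_eq_single_of_mem n hn fun m _ hmn ↦ if_neg (Ne.symm hmn), if_pos rfl]
      _ = M := by rw [← Finset.card_eq_sum_ones, Finset.card_range]
  have hB : ∑ n ∈ Finset.range M, ∑ m ∈ Finset.range M,
      (if n < m ∧ zetaOrdinate m - zetaOrdinate n ≤ δ then 1 else 0) =
      ∑ n ∈ Finset.range M,
        ((Finset.range M).filter fun m ↦ n < m ∧ zetaOrdinate m - zetaOrdinate n ≤ δ).card :=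
    Finset.sum_congr rfl fun n _ ↦ (Finset.card_filter _ _).symm
  have hC : ∑ n ∈ Finset.range M, ∑ m ∈ Finset.range M,
      (if m < n ∧ zetaOrdinate n - zetaOrdinate m ≤ δ then 1 else 0) =
      ∑ n ∈ Finset.range M,
        ((Finset.range M).filter fun m ↦ n < m ∧ zetaOrdinate m - zetaOrdinate n ≤ δ).card := by
    rw [Finset.sum_comm]
    exact Finset.sum_congr rfl fun n _ ↦ (Finset.card_filter _ _).symm
  calc _ ≤ ∑ n ∈ Finset.range M, ∑ m ∈ Finset.range M,
        ((if n = m then 1 else 0) + (if n < m ∧ zetaOrdinate m - zetaOrdinate n ≤ δ then 1 else 0) +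
          (if m < n ∧ zetaOrdinate n - zetaOrdinate m ≤ δ then 1 else 0)) :=
        Finset.sum_le_sum fun n _ ↦ Finset.sum_le_sum fun m _ ↦ hpt n m
    _ = M + 2 * ∑ n ∈ Finset.range M,
        ((Finset.range M).filter fun m ↦ n < m ∧ zetaOrdinate m - zetaOrdinate n ≤ δ).card := by
        simp only [Finset.sum_add_distrib]
        rw [hA, hB, hC]; ring

/-- Pairs versus strictly higher ordinates: `#{(n,m) : |γ_n − γ_m| ≤ δ} ≤ #{(n,m) : γ_n = γ_m} +
2 Σ_n ν'(n)` with `ν'(n) = #{m : γ_n < γ_m ≤ γ_n + δ}` (the printed `Σ m(γ_d)² + Σ_{0<|γ−γ'|≤…} 1`).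
[cite: BuiEtAl2023, §2 (proof of Proposition 1, last display) and §4] -/
theorem card_pairFilter_le' (M : ℕ) (δ : ℝ) :
    ((Finset.range M ×ˢ Finset.range M).filter fun p : ℕ × ℕ ↦
        -δ ≤ zetaOrdinate p.1 - zetaOrdinate p.2 ∧ zetaOrdinate p.1 - zetaOrdinate p.2 ≤ δ).card ≤
      ((Finset.range M ×ˢ Finset.range M).filter fun p : ℕ × ℕ ↦
          zetaOrdinate p.1 = zetaOrdinate p.2).card +
        2 * ∑ n ∈ Finset.range M, ((Finset.range M).filter fun m ↦
          zetaOrdinate n < zetaOrdinate m ∧ zetaOrdinate m - zetaOrdinate n ≤ δ).card := by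
  rw [Finset.card_filter, Finset.sum_product, Finset.card_filter, Finset.sum_product]
  have hpt : ∀ n m : ℕ,
      (if -δ ≤ zetaOrdinate n - zetaOrdinate m ∧ zetaOrdinate n - zetaOrdinate m ≤ δ then 1 else 0) ≤
        (if zetaOrdinate n = zetaOrdinate m then 1 else 0) +
          (if zetaOrdinate n < zetaOrdinate m ∧ zetaOrdinate m - zetaOrdinate n ≤ δ then 1 else 0) +
          (if zetaOrdinate m < zetaOrdinate n ∧ zetaOrdinate n - zetaOrdinate m ≤ δ then 1 else 0) := by
    intro n m
    by_cases h1 : -δ ≤ zetaOrdinate n - zetaOrdinate m ∧ zetaOrdinate n - zetaOrdinate m ≤ δ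
    · rw [if_pos h1]
      rcases lt_trichotomy (zetaOrdinate n) (zetaOrdinate m) with h | h | h
      · have hU : zetaOrdinate n < zetaOrdinate m ∧ zetaOrdinate m - zetaOrdinate n ≤ δ :=
          ⟨h, by linarith [h1.1]⟩
        rw [if_pos hU]; exact Nat.le_add_right_of_le (Nat.le_add_left 1 _)
      · rw [if_pos h]; exact Nat.le_add_right_of_le (Nat.le_add_right 1 _)
      · have hL : zetaOrdinate m < zetaOrdinate n ∧ zetaOrdinate n - zetaOrdinate m ≤ δ := ⟨h, h1.2⟩
        rw [if_pos hL]; exact Nat.le_add_left 1 _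
    · rw [if_neg h1]; exact Nat.zero_le _
  have hB : ∑ n ∈ Finset.range M, ∑ m ∈ Finset.range M,
      (if zetaOrdinate n < zetaOrdinate m ∧ zetaOrdinate m - zetaOrdinate n ≤ δ then 1 else 0) =
      ∑ n ∈ Finset.range M, ((Finset.range M).filter fun m ↦
        zetaOrdinate n < zetaOrdinate m ∧ zetaOrdinate m - zetaOrdinate n ≤ δ).card :=
    Finset.sum_congr rfl fun n _ ↦ (Finset.card_filter _ _).symm
  have hC : ∑ n ∈ Finset.range M, ∑ m ∈ Finset.range M,
      (if zetaOrdinate m < zetaOrdinate n ∧ zetaOrdinate n - zetaOrdinate m ≤ δ then 1 else 0) =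
      ∑ n ∈ Finset.range M, ((Finset.range M).filter fun m ↦
        zetaOrdinate n < zetaOrdinate m ∧ zetaOrdinate m - zetaOrdinate n ≤ δ).card := by
    rw [Finset.sum_comm]
    exact Finset.sum_congr rfl fun n _ ↦ (Finset.card_filter _ _).symm
  calc _ ≤ ∑ n ∈ Finset.range M, ∑ m ∈ Finset.range M,
        ((if zetaOrdinate n = zetaOrdinate m then 1 else 0) +
          (if zetaOrdinate n < zetaOrdinate m ∧ zetaOrdinate m - zetaOrdinate n ≤ δ then 1 else 0) +
          (if zetaOrdinate m < zetaOrdinate n ∧ zetaOrdinate n - zetaOrdinate m ≤ δ then 1 else 0)) :=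
        Finset.sum_le_sum fun n _ ↦ Finset.sum_le_sum fun m _ ↦ hpt n m
    _ = _ := by
        simp only [Finset.sum_add_distrib]
        rw [hB, hC]; ring

/-- If some later index is within `δ`, the very next one is: `#{n : ν(n) ≥ 1} ≤ #{n : γ_{n+1} − γ_n ≤ δ}`
(the spacing count). [cite: BuiEtAl2023, §4 (proof of Theorem 3)] -/
theorem card_filter_latePos_le (M : ℕ) (δ : ℝ) :
    ((Finset.range M).filter fun n ↦
        1 ≤ ((Finset.range M).filter fun m ↦ n < m ∧ zetaOrdinate m - zetaOrdinate n ≤ δ).card).card ≤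
      ((Finset.range M).filter fun n ↦ zetaOrdinate (n + 1) - zetaOrdinate n ≤ δ).card := by
  refine Finset.card_le_card fun n hn ↦ ?_
  rw [Finset.mem_filter] at hn ⊢
  refine ⟨hn.1, ?_⟩
  obtain ⟨m, hm⟩ := Finset.card_pos.1 hn.2
  rw [Finset.mem_filter] at hm
  have hmono := zetaOrdinate_mono_holds (Nat.succ_le_of_lt hm.2.1)
  linarith [hm.2.2]

/-- Cauchy's inequality in the form used twice in §4: for `u : ℕ → ℕ`,
`(Σ_n u(n))² ≤ #{n : u(n) ≥ 1} · Σ_n u(n)²`. [cite: BuiEtAl2023, §4 (4.3)] -/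
theorem sq_sum_le_card_pos_mul_sum_sq (s : Finset ℕ) (u : ℕ → ℕ) :
    (∑ n ∈ s, (u n : ℝ)) ^ 2 ≤ ((s.filter fun n ↦ 1 ≤ u n).card : ℝ) * ∑ n ∈ s, (u n : ℝ) ^ 2 := by
  have h1 : ∑ n ∈ s, (u n : ℝ) = ∑ n ∈ s, (if 1 ≤ u n then (1 : ℝ) else 0) * (u n : ℝ) := by
    refine Finset.sum_congr rfl fun n _ ↦ ?_
    split_ifs with h
    · rw [one_mul]
    · have : u n = 0 := by omega
      simp [this]
  have h2 : ((s.filter fun n ↦ 1 ≤ u n).card : ℝ) = ∑ n ∈ s, (if 1 ≤ u n then (1 : ℝ) else 0) ^ 2 := by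
    rw [Finset.card_filter]
    push_cast
    refine Finset.sum_congr rfl fun n _ ↦ ?_
    split_ifs <;> norm_num
  rw [h1, h2]
  exact Finset.sum_mul_sq_le_sq_mul_sq _ _ _

/-- `ν(n) ≤ N(γ_n + δ) − N(γ_n − δ)` (later indices within `δ` lie in the window `(γ_n − δ, γ_n + δ]`).
[cite: BuiEtAl2023, §4 (4.2)] -/
theorem card_late_le_windowCount {δ : ℝ} (hδ : 0 < δ) (M n : ℕ) :
    (((Finset.range M).filter fun m ↦ n < m ∧ zetaOrdinate m - zetaOrdinate n ≤ δ).card : ℝ) ≤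
      (zetaZeroCount (zetaOrdinate n + δ) : ℝ) - zetaZeroCount (zetaOrdinate n - δ) := by
  refine le_trans ?_ (card_filter_window_le (t := zetaOrdinate n) hδ.le le_rfl M)
  exact_mod_cast Finset.card_le_card fun m hm ↦ by
    rw [Finset.mem_filter] at hm ⊢
    exact ⟨hm.1, by linarith [zetaOrdinate_mono_holds hm.2.1.le], by linarith [hm.2.2]⟩

/-- The top index of a block of equal ordinates (the printed `γ_d` bookkeeping): with
`t(n) = N(γ_n) − 1` one has `n ≤ t(n)`, `γ_{t(n)} = γ_n < γ_{t(n)+1}`, and every `m` with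
`γ_m > γ_n` satisfies `m ≥ t(n) + 1`. [cite: BuiEtAl2023, §2 (2.2) and Titchmarsh1986 §9.1] -/
theorem topIndex_spec (n : ℕ) :
    n ≤ zetaZeroCount (zetaOrdinate n) - 1 ∧
      zetaOrdinate (zetaZeroCount (zetaOrdinate n) - 1) = zetaOrdinate n ∧
      zetaOrdinate n < zetaOrdinate (zetaZeroCount (zetaOrdinate n) - 1 + 1) ∧
      ∀ m : ℕ, zetaOrdinate n < zetaOrdinate m → zetaZeroCount (zetaOrdinate n) - 1 + 1 ≤ m := by
  have h1 : n < zetaZeroCount (zetaOrdinate n) := Montgomery.zetaOrdinate_le_iff_lt.1 le_rfl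
  have h2 : zetaZeroCount (zetaOrdinate n) - 1 + 1 = zetaZeroCount (zetaOrdinate n) :=
    Nat.sub_add_cancel (by omega)
  have ha : n ≤ zetaZeroCount (zetaOrdinate n) - 1 := by omega
  refine ⟨ha, le_antisymm ?_ (zetaOrdinate_mono_holds ha), ?_, fun m hm ↦ ?_⟩
  · exact Montgomery.zetaOrdinate_le_iff_lt.2 (by omega)
  · rw [h2]; exact Montgomery.lt_zetaOrdinate_iff.2 le_rfl
  · rw [h2]; exact Montgomery.lt_zetaOrdinate_iff.1 hm

/-- Multiplicity plus strictly-higher neighbours fit in one window: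
`#{n < M : γ_n = γ_g} + #{m < M : γ_g < γ_m ≤ γ_g + δ} ≤ N(γ_g + δ) − N(γ_g − δ)`.
[cite: BuiEtAl2023, §4 (4.2)–(4.3)] -/
theorem card_eq_add_card_up_le_windowCount {δ : ℝ} (hδ : 0 < δ) (M g : ℕ) :
    ((((Finset.range M).filter fun n ↦ zetaOrdinate n = zetaOrdinate g).card +
        ((Finset.range M).filter fun m ↦
          zetaOrdinate g < zetaOrdinate m ∧ zetaOrdinate m - zetaOrdinate g ≤ δ).card : ℕ) : ℝ) ≤
      (zetaZeroCount (zetaOrdinate g + δ) : ℝ) - zetaZeroCount (zetaOrdinate g - δ) := by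
  refine le_trans ?_ (card_filter_window_le (t := zetaOrdinate g) hδ.le le_rfl M)
  rw [← Finset.card_union_of_disjoint]
  · exact_mod_cast Finset.card_le_card fun m hm ↦ by
      rw [Finset.mem_union, Finset.mem_filter, Finset.mem_filter] at hm
      rw [Finset.mem_filter]
      rcases hm with ⟨hm1, hm2⟩ | ⟨hm1, hm2, hm3⟩
      · exact ⟨hm1, by linarith, by linarith⟩
      · exact ⟨hm1, by linarith, by linarith⟩
  · rw [Finset.disjoint_filter]
    intro m _ h1 h2
    linarith [h2.1]

/-- **Proposition 2 in the currency `N(T)`**: under RH, for `λ > 0` and `j ∈ ℕ`,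
`Σ_{n < N(T)} (N(γ_n + δ) − N(γ_n − δ))^j ≤ C · N(T)` for `T` large, `δ = 2πλ/log T`
(`BGMM2023.sum_windowCount_pow_le_of_RH` and `N(T) ∼ (T/2π) log T`).
[cite: BuiEtAl2023, Proposition 2] -/
theorem sum_windowCount_pow_le_count_of_RH (hRH : RiemannHypothesis) {lam : ℝ} (hlam : 0 < lam)
    (j : ℕ) : ∃ C T₀ : ℝ, 0 < C ∧ ∀ T : ℝ, T₀ ≤ T →
      ∑ n ∈ zeroIndexSet T, ((zetaZeroCount (zetaOrdinate n + 2 * π * lam / Real.log T) : ℝ) -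
          zetaZeroCount (zetaOrdinate n - 2 * π * lam / Real.log T)) ^ j ≤ C * zetaZeroCount T := by
  obtain ⟨C₀, T₀, hC₀, hT₀8, h⟩ :=
    sum_windowCount_pow_le_of_RH hRH (κ := 2 * π * lam) (by positivity) j
  have hN := RudnickSarnak.tendsto_zetaZeroCount_div_main
  have hev : ∀ᶠ T : ℝ in atTop,
      ∑ n ∈ zeroIndexSet T, ((zetaZeroCount (zetaOrdinate n + 2 * π * lam / Real.log T) : ℝ) -
          zetaZeroCount (zetaOrdinate n - 2 * π * lam / Real.log T)) ^ j ≤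
        (4 * π * C₀ + 1) * zetaZeroCount T := by
    filter_upwards [eventually_ge_atTop T₀,
      hN.eventually (lt_mem_nhds (show (1 : ℝ) / 2 < 1 by norm_num))] with T hT hNT
    have hT1 : 1 < T := by linarith
    have hT0 : 0 < T := by linarith
    have hL : 0 < Real.log T := Real.log_pos hT1
    have hδ : 0 < 2 * π * lam / Real.log T := by positivity
    have h1 := h T hT _ hδ le_rfl
    have hM : 0 < T / (2 * π) * Real.log T := by positivity
    have h2 : (1 : ℝ) / 2 < zetaZeroCount T / (T / (2 * π) * Real.log T) := hNT
    rw [lt_div_iff₀ hM] at h2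
    have h3 : T * Real.log T ≤ 4 * π * zetaZeroCount T := by
      have e : T * Real.log T = 4 * π * (1 / 2 * (T / (2 * π) * Real.log T)) := by
        field_simp; ring
      rw [e]; nlinarith [Real.pi_pos, h2]
    have hN0 : (0 : ℝ) ≤ zetaZeroCount T := Nat.cast_nonneg _
    calc _ ≤ C₀ * T * Real.log T := h1
      _ = C₀ * (T * Real.log T) := by ring
      _ ≤ C₀ * (4 * π * zetaZeroCount T) := mul_le_mul_of_nonneg_left h3 hC₀
      _ ≤ (4 * π * C₀ + 1) * zetaZeroCount T := by nlinarith
  obtain ⟨T₁, hT₁⟩ := eventually_atTop.1 hev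
  exact ⟨4 * π * C₀ + 1, T₁, by positivity, hT₁⟩

/-- **Theorem 3, first clause**: RH and `c(λ;r) > 0` for some `r ∈ 𝒜(λ)` give a positive
proportion of spacings `γ_{n+1} − γ_n ≤ 2πλ/log T`. Proposition 1 with `ε = c/2` gives
`Σ_n ν(n) ≥ c N(T)/4`; Cauchy `(Σν)² ≤ #{ν ≥ 1}·Σν²`, `#{ν ≥ 1} ≤ #spacings`, and
`Σν² ≤ Σ W² ≪ N(T)` (Proposition 2). [cite: BuiEtAl2023, Theorem 3 and §4] -/
theorem spacingDensityPos_of_RH (hRH : RiemannHypothesis) {lam : ℝ} (hlam : 0 < lam) {r : ℝ → ℝ}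
    (hr : IsAdmissible r lam) (hc : 0 < cValue r) : SpacingDensityPos lam := by
  set c : ℝ := cValue r with hcdef
  obtain ⟨T₁, hP⟩ := pairCount_ge_of_RH hRH hr (half_pos hc)
  obtain ⟨C₂, T₂, hC₂, hW⟩ := sum_windowCount_pow_le_count_of_RH hRH hlam 2
  refine ⟨c ^ 2 / (16 * C₂), by positivity, max T₁ (max T₂ 2), fun T hT ↦ ?_⟩
  have hT₁ : T₁ ≤ T := le_trans (le_max_left _ _) hT
  have hT₂ : T₂ ≤ T := le_trans ((le_max_left _ _).trans (le_max_right _ _)) hT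
  have hT2 : (2 : ℝ) ≤ T := le_trans ((le_max_right _ _).trans (le_max_right _ _)) hT
  have hL : 0 < Real.log T := Real.log_pos (by linarith)
  set δ : ℝ := 2 * π * lam / Real.log T with hδdef
  have hδ : 0 < δ := by positivity
  set N : ℕ := zetaZeroCount T with hNdef
  set ν : ℕ → ℕ := fun n ↦
    ((Finset.range N).filter fun m ↦ n < m ∧ zetaOrdinate m - zetaOrdinate n ≤ δ).card with hνdef
  -- (i) `#pairs ≤ N + 2 Σ ν`
  have h1 : (pairCorrelationCount (-lam) lam T : ℝ) ≤ N + 2 * ∑ n ∈ Finset.range N, (ν n : ℝ) := by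
    have e : pairCorrelationCount (-lam) lam T =
        ((Finset.range N ×ˢ Finset.range N).filter fun p : ℕ × ℕ ↦
          -δ ≤ zetaOrdinate p.1 - zetaOrdinate p.2 ∧ zetaOrdinate p.1 - zetaOrdinate p.2 ≤ δ).card := by
      unfold pairCorrelationCount zeroIndexSet
      congr 1
      refine Finset.filter_congr fun p _ ↦ ?_
      rw [show 2 * π * -lam / Real.log T = -δ by rw [hδdef]; ring]
    rw [e]
    exact_mod_cast card_pairFilter_le N δ
  -- (ii) `Σ ν ≥ c N / 4`
  have h2 : c / 4 * N ≤ ∑ n ∈ Finset.range N, (ν n : ℝ) := by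
    have hp := hP T hT₁
    linarith
  -- (iii) Cauchy
  have h3 := sq_sum_le_card_pos_mul_sum_sq (Finset.range N) ν
  -- (iv) `#{ν ≥ 1} ≤ #spacings`
  have h4 : (((Finset.range N).filter fun n ↦ 1 ≤ ν n).card : ℝ) ≤ spacingCount lam T := by
    unfold spacingCount
    exact_mod_cast card_filter_latePos_le N δ
  -- (v) `Σ ν² ≤ C₂ N`
  have h5 : ∑ n ∈ Finset.range N, (ν n : ℝ) ^ 2 ≤ C₂ * N := by
    have hW' := hW T hT₂
    refine le_trans (Finset.sum_le_sum fun n _ ↦ ?_) hW'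
    exact pow_le_pow_left₀ (Nat.cast_nonneg _) (card_late_le_windowCount hδ N n) 2
  -- (vi) conclusion
  have hS0 : (0 : ℝ) ≤ spacingCount lam T := Nat.cast_nonneg _
  have key : c ^ 2 / 16 * (N : ℝ) ^ 2 ≤ spacingCount lam T * (C₂ * N) := by
    have hcN : 0 ≤ c / 4 * (N : ℝ) := by positivity
    calc c ^ 2 / 16 * (N : ℝ) ^ 2 = (c / 4 * N) ^ 2 := by ring
      _ ≤ (∑ n ∈ Finset.range N, (ν n : ℝ)) ^ 2 := pow_le_pow_left₀ hcN h2 2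
      _ ≤ _ := h3
      _ ≤ spacingCount lam T * (C₂ * N) :=
          mul_le_mul h4 h5 (Finset.sum_nonneg fun n _ ↦ by positivity) hS0
  rcases Nat.eq_zero_or_pos N with hN0 | hNpos
  · rw [hN0]; simp
  · have hNr : (0 : ℝ) < N := by exact_mod_cast hNpos
    have hCN : 0 < C₂ * (N : ℝ) := mul_pos hC₂ hNr
    have e : c ^ 2 / (16 * C₂) * (N : ℝ) = c ^ 2 / 16 * (N : ℝ) ^ 2 / (C₂ * N) := by
      field_simp
    rw [e, div_le_iff₀ hCN]
    exact key

/-- **Theorem 3, second clause**: RH and (2.5) with `ν < c(λ;r) + 1` give a positive proportion of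
gaps `0 < γ_{n+1} − γ_n ≤ 2πλ/log T` between DISTINCT consecutive ordinates. With
`ε = (c + 1 − ν)/2`, Proposition 1 and (2.5) give `Σ_n ν'(n) ≥ ε N(T)/2`
(`ν'(n) = #{γ' : γ_n < γ' ≤ γ_n + 2πλ/log T}`); grouping the `n` by the top index of their block
(`b = ` multiplicity), Cauchy gives `(Σ b ν')² ≤ #{tops with ν' ≥ 1} · Σ (bν')²`, each such top is
a small DISTINCT gap, and `(bν')² ≤ W⁴` with `Σ W⁴ ≪ N(T)` (Proposition 2).
[cite: BuiEtAl2023, Theorem 3 and §4] -/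
theorem gapDensityPos_of_RH (hRH : RiemannHypothesis) {lam : ℝ} (hlam : 0 < lam) {r : ℝ → ℝ}
    (hr : IsAdmissible r lam) {ν₀ : ℝ} (hν₀ : ν₀ < cValue r + 1) {T₀' : ℝ}
    (hmult : ∀ T : ℝ, T₀' ≤ T → (multPairCount T : ℝ) ≤ ν₀ * zetaZeroCount T) :
    GapDensityPos lam := by
  set c : ℝ := cValue r with hcdef
  set ε : ℝ := (c + 1 - ν₀) / 2 with hεdef
  have hε : 0 < ε := by rw [hεdef]; linarith
  obtain ⟨T₁, hP⟩ := pairCount_ge_of_RH hRH hr hε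
  obtain ⟨C₄, T₂, hC₄, hW⟩ := sum_windowCount_pow_le_count_of_RH hRH hlam 4
  refine ⟨ε ^ 2 / (4 * C₄), by positivity, max (max T₀' T₁) (max T₂ 2), fun T hT ↦ ?_⟩
  have hT₀' : T₀' ≤ T := le_trans ((le_max_left _ _).trans (le_max_left _ _)) hT
  have hT₁ : T₁ ≤ T := le_trans ((le_max_right _ _).trans (le_max_left _ _)) hT
  have hT₂ : T₂ ≤ T := le_trans ((le_max_left _ _).trans (le_max_right _ _)) hT
  have hT2 : (2 : ℝ) ≤ T := le_trans ((le_max_right _ _).trans (le_max_right _ _)) hT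
  have hL : 0 < Real.log T := Real.log_pos (by linarith)
  set δ : ℝ := 2 * π * lam / Real.log T with hδdef
  have hδ : 0 < δ := by positivity
  set N : ℕ := zetaZeroCount T with hNdef
  set up : ℕ → ℕ := fun n ↦ ((Finset.range N).filter fun m ↦
    zetaOrdinate n < zetaOrdinate m ∧ zetaOrdinate m - zetaOrdinate n ≤ δ).card with hupdef
  set top : ℕ → ℕ := fun n ↦ zetaZeroCount (zetaOrdinate n) - 1 with htopdef
  -- (i) `#pairs ≤ #equal pairs + 2 Σ ν'`
  have h1 : (pairCorrelationCount (-lam) lam T : ℝ) ≤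
      multPairCount T + 2 * ∑ n ∈ Finset.range N, (up n : ℝ) := by
    have e : pairCorrelationCount (-lam) lam T =
        ((Finset.range N ×ˢ Finset.range N).filter fun p : ℕ × ℕ ↦
          -δ ≤ zetaOrdinate p.1 - zetaOrdinate p.2 ∧ zetaOrdinate p.1 - zetaOrdinate p.2 ≤ δ).card := by
      unfold pairCorrelationCount zeroIndexSet
      congr 1
      refine Finset.filter_congr fun p _ ↦ ?_
      rw [show 2 * π * -lam / Real.log T = -δ by rw [hδdef]; ring]
    rw [e]
    unfold multPairCount
    exact_mod_cast card_pairFilter_le' N δ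
  -- (ii) `Σ ν' ≥ ε N / 2`
  have h2 : ε / 2 * N ≤ ∑ n ∈ Finset.range N, (up n : ℝ) := by
    have hp := hP T hT₁
    have hm := hmult T hT₀'
    have e : 1 + c - ε = ν₀ + ε := by rw [hεdef]; ring
    rw [e] at hp
    linarith
  -- (iii) the top index: `ν'(n) = ν'(t(n))`, `t(n) < N` for `n < N`
  have htop_up : ∀ n, up n = up (top n) := by
    intro n
    obtain ⟨-, hγ, -⟩ := topIndex_spec n
    simp only [hupdef, htopdef]
    rw [hγ]
  have htop_mem : ∀ n ∈ Finset.range N, top n ∈ Finset.range N := by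
    intro n hn
    obtain ⟨-, hγ, -⟩ := topIndex_spec n
    have hnT : zetaOrdinate n ≤ T :=
      (mem_zeroIndexSet_iff_holds (T := T) (n := n)).1 (by simpa [zeroIndexSet] using hn)
    rw [Finset.mem_range]
    exact Montgomery.zetaOrdinate_le_iff_lt.1 (by rw [htopdef]; dsimp only; rw [hγ]; exact hnT)
  -- regrouping `Σ_n ν'(n) = Σ_{tops g} b(g) ν'(g)`
  set s' : Finset ℕ := (Finset.range N).image top with hs'def
  set b : ℕ → ℕ := fun g ↦ ((Finset.range N).filter fun n ↦ top n = g).card with hbdef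
  have h3 : ∑ n ∈ Finset.range N, (up n : ℝ) = ∑ g ∈ s', ((b g * up g : ℕ) : ℝ) := by
    have hnat : ∑ n ∈ Finset.range N, up n = ∑ g ∈ s', b g * up g := by
      rw [Finset.sum_congr rfl fun n _ ↦ htop_up n, Finset.sum_comp]
      rfl
    exact_mod_cast congrArg (Nat.cast : ℕ → ℝ) hnat
  -- (iv) Cauchy over the tops
  have h4 := sq_sum_le_card_pos_mul_sum_sq s' (fun g ↦ b g * up g)
  -- (v) tops with `ν' ≥ 1` are small distinct gaps
  have h5 : ((s'.filter fun g ↦ 1 ≤ b g * up g).card : ℝ) ≤ gapCount lam T := by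
    unfold gapCount
    exact_mod_cast Finset.card_le_card fun g hg ↦ by
      rw [Finset.mem_filter] at hg ⊢
      obtain ⟨hg1, hg2⟩ := hg
      obtain ⟨n, hn, rfl⟩ := Finset.mem_image.1 hg1
      obtain ⟨hle, hγ, hlt, hmin⟩ := topIndex_spec n
      have hup : 1 ≤ up (top n) := by
        rcases Nat.eq_zero_or_pos (up (top n)) with h0 | h0
        · rw [h0, mul_zero] at hg2; omega
        · exact h0
      obtain ⟨m, hm⟩ := Finset.card_pos.1 hup
      rw [Finset.mem_filter] at hm
      have hγ' : zetaOrdinate (top n) = zetaOrdinate n := hγ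
      refine ⟨htop_mem n hn, ?_, ?_⟩
      · rw [hγ']; exact hlt
      · have h6 : top n + 1 ≤ m := hmin m (by rw [← hγ']; exact hm.2.1)
        have h7 := zetaOrdinate_mono_holds h6
        linarith [hm.2.2]
  -- (vi) `Σ (b ν')² ≤ Σ W⁴ ≤ C₄ N`
  have h6 : ∑ g ∈ s', ((b g * up g : ℕ) : ℝ) ^ 2 ≤ C₄ * N := by
    have hs' : s' ⊆ Finset.range N := fun g hg ↦ by
      obtain ⟨n, hn, rfl⟩ := Finset.mem_image.1 hg
      exact htop_mem n hn
    have hW' := hW T hT₂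
    have hWnn : ∀ g : ℕ, (0 : ℝ) ≤ (zetaZeroCount (zetaOrdinate g + δ) : ℝ) -
        zetaZeroCount (zetaOrdinate g - δ) := fun g ↦ windowCount_nonneg hδ.le _
    calc ∑ g ∈ s', ((b g * up g : ℕ) : ℝ) ^ 2
        ≤ ∑ g ∈ s', ((zetaZeroCount (zetaOrdinate g + δ) : ℝ) -
            zetaZeroCount (zetaOrdinate g - δ)) ^ 4 := by
          refine Finset.sum_le_sum fun g _ ↦ ?_
          have hbsub : b g ≤ ((Finset.range N).filter fun n ↦ zetaOrdinate n = zetaOrdinate g).card := by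
            refine Finset.card_le_card fun n hn ↦ ?_
            rw [Finset.mem_filter] at hn ⊢
            refine ⟨hn.1, ?_⟩
            obtain ⟨-, hγ, -⟩ := topIndex_spec n
            have : top n = g := hn.2
            rw [← this]; exact hγ.symm
          have hbu : ((b g : ℕ) : ℝ) + up g ≤ (zetaZeroCount (zetaOrdinate g + δ) : ℝ) -
              zetaZeroCount (zetaOrdinate g - δ) := by
            have := card_eq_add_card_up_le_windowCount hδ N g
            push_cast at this
            have hb' : ((b g : ℕ) : ℝ) ≤ ((Finset.range N).filter fun n ↦
                zetaOrdinate n = zetaOrdinate g).card := by exact_mod_cast hbsub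
            linarith
          have hB0 : (0 : ℝ) ≤ b g := Nat.cast_nonneg _
          have hU0 : (0 : ℝ) ≤ up g := Nat.cast_nonneg _
          have h8 : ((b g : ℕ) : ℝ) * up g ≤ ((zetaZeroCount (zetaOrdinate g + δ) : ℝ) -
              zetaZeroCount (zetaOrdinate g - δ)) ^ 2 := by
            nlinarith [hbu, hB0, hU0, sq_nonneg (((b g : ℕ) : ℝ) - up g)]
          push_cast
          calc (((b g : ℕ) : ℝ) * up g) ^ 2 ≤ (((zetaZeroCount (zetaOrdinate g + δ) : ℝ) -
              zetaZeroCount (zetaOrdinate g - δ)) ^ 2) ^ 2 :=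
                pow_le_pow_left₀ (mul_nonneg hB0 hU0) h8 2
            _ = _ := by ring
      _ ≤ ∑ g ∈ Finset.range N, ((zetaZeroCount (zetaOrdinate g + δ) : ℝ) -
            zetaZeroCount (zetaOrdinate g - δ)) ^ 4 :=
          Finset.sum_le_sum_of_subset_of_nonneg hs' fun g _ _ ↦ pow_nonneg (hWnn g) 4
      _ ≤ C₄ * N := hW'
  -- (vii) conclusion
  have hG0 : (0 : ℝ) ≤ gapCount lam T := Nat.cast_nonneg _
  have key : ε ^ 2 / 4 * (N : ℝ) ^ 2 ≤ gapCount lam T * (C₄ * N) := by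
    have hεN : 0 ≤ ε / 2 * (N : ℝ) := by positivity
    calc ε ^ 2 / 4 * (N : ℝ) ^ 2 = (ε / 2 * N) ^ 2 := by ring
      _ ≤ (∑ n ∈ Finset.range N, (up n : ℝ)) ^ 2 := pow_le_pow_left₀ hεN h2 2
      _ = (∑ g ∈ s', ((b g * up g : ℕ) : ℝ)) ^ 2 := by rw [h3]
      _ ≤ _ := h4
      _ ≤ gapCount lam T * (C₄ * N) :=
          mul_le_mul h5 h6 (Finset.sum_nonneg fun n _ ↦ sq_nonneg _) hG0
  rcases Nat.eq_zero_or_pos N with hN0 | hNpos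
  · rw [hN0]; simp
  · have hNr : (0 : ℝ) < N := by exact_mod_cast hNpos
    have hCN : 0 < C₄ * (N : ℝ) := mul_pos hC₄ hNr
    have e : ε ^ 2 / (4 * C₄) * (N : ℝ) = ε ^ 2 / 4 * (N : ℝ) ^ 2 / (C₄ * N) := by
      field_simp
    rw [e, div_le_iff₀ hCN]
    exact key

end BGMM2023

/-- **Theorem 3 of Bui–Goldston–Milinovich–Montgomery (2023) — discharge of the named fact
`Literature.NumberTheory.LFunctions.buiEtAl2023_theorem3`.** Assume RH. (1) If `c(λ;r) > 0` for some
`r ∈ 𝒜(λ)`, a positive proportion of consecutive ordinates satisfy `γ_{n+1} − γ_n ≤ 2πλ/log T`;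
(2) if moreover (2.5) holds for some `ν < c(λ;r) + 1` (here: `#{(γ,γ') : γ = γ'} ≤ ν N(T)` for
large `T`), a positive proportion of the gaps between DISTINCT consecutive zeros are
`≤ 2πλ/log T`. Proof = Proposition 1 (`BGMM2023.pairCount_ge_of_RH`) + Proposition 2
(`BGMM2023.sum_windowCount_pow_le_of_RH`, sibling file) + the §4 Cauchy–Schwarz assembly
(`BGMM2023.spacingDensityPos_of_RH`, `BGMM2023.gapDensityPos_of_RH`).
[cite: BuiEtAl2023, Theorem 3] -/
theorem buiEtAl2023_theorem3_holds : buiEtAl2023_theorem3 := fun hRH ↦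
  ⟨fun _lam _r hlam hr hc ↦ BGMM2023.spacingDensityPos_of_RH hRH hlam hr hc,
    fun _lam _r hlam hr hν ↦ by
      obtain ⟨ν₀, hν₀, T₀, hT₀⟩ := hν
      exact BGMM2023.gapDensityPos_of_RH hRH hlam hr hν₀ hT₀⟩

end Literature.NumberTheory.LFunctions

end
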